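import Mathlib
import HarnessLib
import Summits.PneNP.PneNP.Theorems.CnfIdealGenLengthRankDefectRepresentationsCutLemmaCutDomination
import Summits.PneNP.PneNP.Theorems.CnfIdealGenLengthRankDefectRepresentationsCutLemmaMonotoneCuts

/-!
# Cut domination for cube-coloured matrices; the additive cut inequality (A)
(crux `RankDefectRepresentations`, stmt-PneNP-18923; line `rank-dehn-ladder`, rung N1)

Rows `x : ι` and columns `y : ι'` of `R` carry cube colours `row x, col y : Fin n → Bool`.  For a set `B` of colours the
`B`-CUT of `R` consists of the two blocks `(row ∈ B) × (col ∉ B)` and `(row ∉ B) × (col ∈ B)`; the `j`-th coordinate cut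
`R ∘ 1[row_j ≠ col_j]` is the `B`-cut for `B = {σ | σ_j = 1}`.  From the polymatroid inequality
`…CutLemmaCutDomination.cut_domination` applied to `A ↦ dim span{e_y : col y ∈ A} ∪ {R_x : row x ∈ A}` we get

* `bipartitionCut_le_sum_coordinateCuts`: for EVERY `B`,
  `rank R|_{(row∈B)×(col∉B)} + rank R|_{(row∉B)×(col∈B)} ≤ ∑_j rank (R ∘ 1[row_j ≠ col_j])`;
* with `B` = the set of row colours this is the ADDITIVE CUT INEQUALITY (A) of `Lines/rank-dehn-ladder-A-problem.md` §1
  (`…CutLemmaMaxCut.rank_le_sum_cuts_of_colourDisjoint`).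

This is Corollary 1 of `Lines/rank-dehn-ladder-N1-proof.md` (lead g7).  Together with the max-cut decomposition
(`…CutLemmaMaxCut`) it proves the registered stub `stub_cutLemma`.
HONEST FRAMING: negative-lane tool for the crux; P ≠ NP is not moved; F-N2 is a FRONTIER formal rung.
-/

set_option linter.dupNamespace false -- `Summit.PneNP.PneNP.…`: summit = sub-problem name (D-0017)

namespace Summit.PneNP.PneNP.Theorems.CnfIdealGenLengthRankDefectRepresentationsCutLemmaCutDominationMatrix

open Finset Matrix Module
open Summit.PneNP.PneNP.Theorems.CnfIdealGenLengthRankDefectRepresentationsCutLemmaCutDomination (cut_domination)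
open Summit.PneNP.PneNP.Theorems.CnfIdealGenLengthRankDefectRepresentationsCutLemmaMonotoneCuts
  (rank_blocks_le_of_lowerLeft_zero rank_pad_le)
open Literature.Computability.AlgebraicComplexity (rank_add_le)

variable {K : Type} [Field K]

section RowColoured

variable {κ ι' Q : Type} [Fintype κ] [Fintype ι'] [DecidableEq Q]

/-- The rank of `M` with the rows whose colour lies outside `S` zeroed is the dimension of the span of the selected rows.
[folklore] -/
theorem rank_rowSelect_eq (c : κ → Q) (M : Matrix κ ι' K) (S : Finset Q) :
    (Matrix.of fun z y => if c z ∈ S then M z y else 0).rank =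
      finrank K (Submodule.span K (M '' {z | c z ∈ S})) := by
  rw [Matrix.rank_eq_finrank_span_row]
  have hspan : Submodule.span K (Set.range (Matrix.of fun z y => if c z ∈ S then M z y else 0).row) =
      Submodule.span K (M '' {z | c z ∈ S}) := by
    apply le_antisymm
    · apply Submodule.span_le.mpr
      rintro v ⟨z, rfl⟩
      by_cases hz : c z ∈ S
      · apply Submodule.subset_span
        refine ⟨z, hz, ?_⟩
        ext y; simp [Matrix.row, hz]
      · have : (Matrix.of fun z y => if c z ∈ S then M z y else 0).row z = 0 := by
          ext y; simp [Matrix.row, hz]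
        rw [this]; exact Submodule.zero_mem _
    · apply Submodule.span_le.mpr
      rintro v ⟨z, hz, rfl⟩
      apply Submodule.subset_span
      refine ⟨z, ?_⟩
      ext y; simp [Matrix.row, show c z ∈ S from hz]
  rw [hspan]

/-- Selecting more row-colour classes does not decrease the rank. [folklore] -/
theorem rank_rowSelect_mono (c : κ → Q) (M : Matrix κ ι' K) {S T : Finset Q} (hST : S ⊆ T) :
    (Matrix.of fun z y => if c z ∈ S then M z y else 0).rank ≤
      (Matrix.of fun z y => if c z ∈ T then M z y else 0).rank := by
  rw [rank_rowSelect_eq, rank_rowSelect_eq]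
  exact Submodule.finrank_mono (Submodule.span_mono (Set.image_mono fun z hz => hST hz))

/-- **Row-class selection is submodular**: `rank M_{S ∪ T} + rank M_{S ∩ T} ≤ rank M_S + rank M_T` (the rank function of the
row matroid, aggregated over colour classes). [folklore] -/
theorem rank_rowSelect_submod (c : κ → Q) (M : Matrix κ ι' K) (S T : Finset Q) :
    (Matrix.of fun z y => if c z ∈ S ∪ T then M z y else 0).rank +
      (Matrix.of fun z y => if c z ∈ S ∩ T then M z y else 0).rank ≤
      (Matrix.of fun z y => if c z ∈ S then M z y else 0).rank +
      (Matrix.of fun z y => if c z ∈ T then M z y else 0).rank := by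
  simp only [rank_rowSelect_eq]
  have hspan_union : Submodule.span K (M '' {z | c z ∈ S ∪ T}) =
      Submodule.span K (M '' {z | c z ∈ S}) ⊔ Submodule.span K (M '' {z | c z ∈ T}) := by
    rw [← Submodule.span_union, ← Set.image_union]
    congr 2
    ext z; simp
  have hspan_inter : Submodule.span K (M '' {z | c z ∈ S ∩ T}) ≤
      Submodule.span K (M '' {z | c z ∈ S}) ⊓ Submodule.span K (M '' {z | c z ∈ T}) := by
    refine le_inf (Submodule.span_mono (Set.image_mono ?_)) (Submodule.span_mono (Set.image_mono ?_))
    · intro z hz; simp only [Set.mem_setOf_eq, mem_inter] at hz ⊢; exact hz.1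
    · intro z hz; simp only [Set.mem_setOf_eq, mem_inter] at hz ⊢; exact hz.2
  have e1 := Submodule.finrank_sup_add_finrank_inf_eq (Submodule.span K (M '' {z | c z ∈ S}))
    (Submodule.span K (M '' {z | c z ∈ T}))
  have e2 := Submodule.finrank_mono hspan_inter
  rw [hspan_union]
  omega

/-- **Cut domination for row-coloured matrices.**  If the rows of `M` are coloured by the cube `Fin n → Bool` and `M_S`
denotes `M` with the rows coloured outside `S` zeroed, then for every `B`
`rank M_B + rank M_Bᶜ + (n - 1) · rank M_univ ≤ ∑_j (rank M_{σ_j = 0} + rank M_{σ_j = 1})`. [folklore] -/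
theorem rowColoured_cut_domination {n : ℕ} (c : κ → Fin n → Bool) (M : Matrix κ ι' K)
    (B : Finset (Fin n → Bool)) :
    ((Matrix.of fun z y => if c z ∈ B then M z y else 0).rank : ℤ) +
      ((Matrix.of fun z y => if c z ∈ Bᶜ then M z y else 0).rank : ℤ) +
      ((n : ℤ) - 1) * ((Matrix.of fun z y => if c z ∈ (univ : Finset (Fin n → Bool)) then M z y else 0).rank : ℤ) ≤
      ∑ j : Fin n, (((Matrix.of fun z y => if c z ∈ univ.filter (fun σ : Fin n → Bool => σ j = false)
          then M z y else 0).rank : ℤ) +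
        ((Matrix.of fun z y => if c z ∈ univ.filter (fun σ : Fin n → Bool => σ j = true)
          then M z y else 0).rank : ℤ)) := by
  classical
  -- the polymatroid `S ↦ rank M_S`
  set h : Finset (Fin n → Bool) → ℤ := fun S => ((Matrix.of fun z y => if c z ∈ S then M z y else 0).rank : ℤ)
    with hh
  have h0 : h ∅ = 0 := by
    simp only [hh, Finset.notMem_empty, if_false]
    have : (Matrix.of fun (z : κ) (y : ι') => (0 : K)) = 0 := rfl
    rw [this, Matrix.rank_zero]; simp
  have hmono : ∀ A A', A ⊆ A' → h A ≤ h A' := by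
    intro A A' hA
    simp only [hh]
    exact_mod_cast rank_rowSelect_mono c M hA
  have hsub : ∀ A A', h (A ∪ A') + h (A ∩ A') ≤ h A + h A' := by
    intro A A'
    simp only [hh]
    exact_mod_cast rank_rowSelect_submod c M A A'
  have main := cut_domination n h h0 hmono hsub B
  simpa only [hh] using main

end RowColoured

section Cube

variable {ι ι' : Type} [Fintype ι] [Fintype ι'] [DecidableEq ι] [DecidableEq ι'] {n : ℕ}

omit [Fintype ι] [DecidableEq ι] [DecidableEq ι'] in
/-- Ranks of sub-rectangles cut out by pointwise-equivalent predicates agree. [folklore] -/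
theorem rank_submatrix_congr (R : Matrix ι ι' K) {p p' : ι → Prop} {q q' : ι' → Prop}
    [DecidablePred p] [DecidablePred p'] [DecidablePred q] [DecidablePred q']
    (hp : ∀ x, p x ↔ p' x) (hq : ∀ y, q y ↔ q' y) :
    (R.submatrix (Subtype.val : {x // p x} → ι) (Subtype.val : {y // q y} → ι')).rank =
      (R.submatrix (Subtype.val : {x // p' x} → ι) (Subtype.val : {y // q' y} → ι')).rank := by
  have : R.submatrix (Subtype.val : {x // p x} → ι) (Subtype.val : {y // q y} → ι') =
      (R.submatrix (Subtype.val : {x // p' x} → ι) (Subtype.val : {y // q' y} → ι')).submatrix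
        (Equiv.subtypeEquivRight hp) (Equiv.subtypeEquivRight hq) := by
    ext x y; rfl
  rw [this, Matrix.rank_submatrix]

omit [Fintype ι] [DecidableEq ι] in
/-- The stacked matrix `N = [coordinate rows e_y ; rows of R]` on `ι' ⊕ ι`, rows coloured by `col ⊔ row`, with the rows
coloured outside `A` zeroed: LOWER bound `#{y : col y ∈ A} + rank R|_{(row∈A)×(col∉A)} ≤ rank N_A`. [folklore] -/
theorem card_add_rank_le_rank_stack (row : ι → Fin n → Bool) (col : ι' → Fin n → Bool) (R : Matrix ι ι' K)
    (A : Finset (Fin n → Bool)) :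
    Fintype.card {y // col y ∈ A} +
      (R.submatrix (Subtype.val : {x // row x ∈ A} → ι) (Subtype.val : {y // col y ∉ A} → ι')).rank ≤
      (Matrix.of fun (z : ι' ⊕ ι) (y' : ι') => if Sum.elim col row z ∈ A then
        Matrix.fromRows (1 : Matrix ι' ι' K) R z y' else 0).rank := by
  classical
  set N : Matrix (ι' ⊕ ι) ι' K := Matrix.of fun (z : ι' ⊕ ι) (y' : ι') =>
    if Sum.elim col row z ∈ A then Matrix.fromRows (1 : Matrix ι' ι' K) R z y' else 0 with hN
  have hblocks := rank_blocks_le_of_lowerLeft_zero N (fun z => Sum.isRight z = true) (fun y' => col y' ∉ A)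
    (by
      rintro (y | x) y' hz hy'
      · simp only [hN, Matrix.of_apply, Sum.elim_inl, Matrix.fromRows_apply_inl]
        by_cases hy : col y ∈ A
        · rw [if_pos hy, Matrix.one_apply, if_neg]
          rintro rfl; exact hy' hy
        · rw [if_neg hy]
      · simp at hz)
  have h1 : (R.submatrix (Subtype.val : {x // row x ∈ A} → ι) (Subtype.val : {y // col y ∉ A} → ι')).rank ≤
      (N.submatrix (Subtype.val : {z // Sum.isRight z = true} → ι' ⊕ ι)
        (Subtype.val : {y' // col y' ∉ A} → ι')).rank := by
    have e1 : R.submatrix (Subtype.val : {x // row x ∈ A} → ι) (Subtype.val : {y // col y ∉ A} → ι') =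
        (N.submatrix (Subtype.val : {z // Sum.isRight z = true} → ι' ⊕ ι)
          (Subtype.val : {y' // col y' ∉ A} → ι')).submatrix
          (fun x => (⟨Sum.inr x.1, rfl⟩ : {z : ι' ⊕ ι // Sum.isRight z = true})) id := by
      ext x y
      simp [hN, x.2]
    rw [e1]
    exact Matrix.rank_submatrix_le _ _ _
  have h2 : Fintype.card {y // col y ∈ A} ≤
      (N.submatrix (Subtype.val : {z // ¬ Sum.isRight z = true} → ι' ⊕ ι)
        (Subtype.val : {y' // ¬ col y' ∉ A} → ι')).rank := by
    have e1 : (1 : Matrix {y // col y ∈ A} {y // col y ∈ A} K) =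
        (N.submatrix (Subtype.val : {z // ¬ Sum.isRight z = true} → ι' ⊕ ι)
          (Subtype.val : {y' // ¬ col y' ∉ A} → ι')).submatrix
          (fun y => (⟨Sum.inl y.1, by simp⟩ : {z : ι' ⊕ ι // ¬ Sum.isRight z = true}))
          (fun y => (⟨y.1, not_not.mpr y.2⟩ : {y' // ¬ col y' ∉ A})) := by
      ext y y'
      simp only [Matrix.submatrix_apply, hN, Matrix.of_apply, Sum.elim_inl, Matrix.fromRows_apply_inl,
        if_pos y.2, Matrix.one_apply]
      by_cases h : y = y'
      · subst h; simp
      · rw [if_neg h, if_neg]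
        intro h'; exact h (Subtype.ext h')
    have := Matrix.rank_submatrix_le
      (N.submatrix (Subtype.val : {z // ¬ Sum.isRight z = true} → ι' ⊕ ι)
        (Subtype.val : {y' // ¬ col y' ∉ A} → ι'))
      (fun y : {y // col y ∈ A} => (⟨Sum.inl y.1, by simp⟩ : {z : ι' ⊕ ι // ¬ Sum.isRight z = true}))
      (fun y : {y // col y ∈ A} => (⟨y.1, not_not.mpr y.2⟩ : {y' // ¬ col y' ∉ A}))
    rw [← e1, Matrix.rank_one] at this
    exact this
  omega

/-- The same stacked matrix: UPPER bound `rank N_A ≤ #{y : col y ∈ A} + rank R|_{(row∈A)×(col∉A)}`. [folklore] -/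
theorem rank_stack_le_card_add_rank (row : ι → Fin n → Bool) (col : ι' → Fin n → Bool) (R : Matrix ι ι' K)
    (A : Finset (Fin n → Bool)) :
    (Matrix.of fun (z : ι' ⊕ ι) (y' : ι') => if Sum.elim col row z ∈ A then
        Matrix.fromRows (1 : Matrix ι' ι' K) R z y' else 0).rank ≤
      Fintype.card {y // col y ∈ A} +
      (R.submatrix (Subtype.val : {x // row x ∈ A} → ι) (Subtype.val : {y // col y ∉ A} → ι')).rank := by
  classical
  set N : Matrix (ι' ⊕ ι) ι' K := Matrix.of fun (z : ι' ⊕ ι) (y' : ι') =>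
    if Sum.elim col row z ∈ A then Matrix.fromRows (1 : Matrix ι' ι' K) R z y' else 0 with hN
  set N₁ : Matrix (ι' ⊕ ι) ι' K := Matrix.of fun z y' => if col y' ∈ A then N z y' else 0 with hN₁
  set N₂ : Matrix (ι' ⊕ ι) ι' K := Matrix.of fun z y' => if col y' ∈ A then 0 else N z y' with hN₂
  have hsplit : N = N₁ + N₂ := by
    ext z y'; simp only [hN₁, hN₂, Matrix.add_apply, Matrix.of_apply]; split_ifs <;> simp
  have h1 : N₁.rank ≤ Fintype.card {y // col y ∈ A} := by
    have e1 : N₁ = (N₁.submatrix id (Subtype.val : {y // col y ∈ A} → ι')) *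
        (Matrix.of fun (b : {y // col y ∈ A}) (y' : ι') => if y' = b.1 then (1 : K) else 0) := by
      ext z y'
      simp only [Matrix.mul_apply, Matrix.submatrix_apply, id_eq, Matrix.of_apply, mul_ite, mul_one, mul_zero]
      by_cases hy : col y' ∈ A
      · rw [Finset.sum_eq_single (⟨y', hy⟩ : {y // col y ∈ A})]
        · simp [hN₁, hy]
        · intro b _ hb; rw [if_neg]; intro h; exact hb (Subtype.ext h.symm)
        · intro h; exact absurd (Finset.mem_univ _) h
      · rw [Finset.sum_eq_zero]
        · simp [hN₁, hy]
        · intro b _; rw [if_neg]; rintro rfl; exact hy b.2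
    rw [e1]
    exact (Matrix.rank_mul_le_left _ _).trans (Matrix.rank_le_card_width _)
  have h2 : N₂.rank ≤
      (R.submatrix (Subtype.val : {x // row x ∈ A} → ι) (Subtype.val : {y // col y ∉ A} → ι')).rank := by
    set M' : Matrix ι ι' K := Matrix.of fun x y' =>
      if hx : row x ∈ A then (if hy : col y' ∉ A then
        (R.submatrix (Subtype.val : {x // row x ∈ A} → ι) (Subtype.val : {y // col y ∉ A} → ι')) ⟨x, hx⟩ ⟨y', hy⟩
        else 0) else 0 with hM'
    have e1 : N₂ = (Matrix.of fun (z : ι' ⊕ ι) (x' : ι) => if z = Sum.inr x' then (1 : K) else 0) * M' := by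
      ext z y'
      rcases z with y | x
      · simp only [hN₂, hN, Matrix.of_apply, Sum.elim_inl, Matrix.fromRows_apply_inl, Matrix.mul_apply,
          reduceCtorEq, if_false, zero_mul, Finset.sum_const_zero]
        by_cases hy' : col y' ∈ A
        · rw [if_pos hy']
        · rw [if_neg hy']
          by_cases hy : col y ∈ A
          · rw [if_pos hy, Matrix.one_apply, if_neg]; rintro rfl; exact hy' hy
          · rw [if_neg hy]
      · simp only [hN₂, hN, Matrix.of_apply, Sum.elim_inr, Matrix.fromRows_apply_inr, Matrix.mul_apply,
          Sum.inr.injEq, ite_mul, one_mul, zero_mul, Finset.sum_ite_eq, Finset.mem_univ, if_true, hM',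
          Matrix.submatrix_apply]
        by_cases hy' : col y' ∈ A
        · rw [if_pos hy']; by_cases hx : row x ∈ A
          · rw [dif_pos hx, dif_neg (not_not.mpr hy')]
          · rw [dif_neg hx]
        · rw [if_neg hy']; by_cases hx : row x ∈ A
          · rw [if_pos hx, dif_pos hx, dif_pos hy']
          · rw [if_neg hx, dif_neg hx]
    rw [e1]
    refine (Matrix.rank_mul_le_right _ _).trans ?_
    exact rank_pad_le (fun x => row x ∈ A) (fun y => col y ∉ A) _
  rw [hsplit]
  exact (rank_add_le _ _).trans (Nat.add_le_add h1 h2)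

/-- **Every bipartition cut is dominated by the coordinate cuts.**  For any set `B` of colours,
`rank R|_{(row∈B)×(col∉B)} + rank R|_{(row∉B)×(col∈B)} ≤ ∑_j rank (R ∘ 1[row_j ≠ col_j])`. [folklore] -/
theorem bipartitionCut_le_sum_coordinateCuts (row : ι → Fin n → Bool) (col : ι' → Fin n → Bool) (R : Matrix ι ι' K)
    (B : Finset (Fin n → Bool)) :
    (R.submatrix (Subtype.val : {x // row x ∈ B} → ι) (Subtype.val : {y // col y ∉ B} → ι')).rank +
      (R.submatrix (Subtype.val : {x // row x ∉ B} → ι) (Subtype.val : {y // col y ∈ B} → ι')).rank ≤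
      ∑ j : Fin n, (Matrix.of fun x y => if row x j ≠ col y j then R x y else 0).rank := by
  classical
  -- the stacked matrix and its row-selections
  have main := rowColoured_cut_domination (K := K) (Sum.elim col row) (Matrix.fromRows (1 : Matrix ι' ι' K) R) B
  have loB := card_add_rank_le_rank_stack (K := K) row col R B
  have loBc := card_add_rank_le_rank_stack (K := K) row col R Bᶜ
  have louniv := card_add_rank_le_rank_stack (K := K) row col R univ
  have hi : ∀ (j : Fin n) (b : Bool),
      (Matrix.of fun (z : ι' ⊕ ι) (y' : ι') => if Sum.elim col row z ∈ univ.filter (fun σ : Fin n → Bool => σ j = b)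
        then Matrix.fromRows (1 : Matrix ι' ι' K) R z y' else 0).rank ≤
      Fintype.card {y // col y ∈ univ.filter (fun σ : Fin n → Bool => σ j = b)} +
      (R.submatrix (Subtype.val : {x // row x ∈ univ.filter (fun σ : Fin n → Bool => σ j = b)} → ι)
        (Subtype.val : {y // col y ∉ univ.filter (fun σ : Fin n → Bool => σ j = b)} → ι')).rank :=
    fun j b => rank_stack_le_card_add_rank (K := K) row col R _
  -- the two blocks of the `j`-th coordinate cut
  have hcut : ∀ j : Fin n,
      (R.submatrix (Subtype.val : {x // row x ∈ univ.filter (fun σ : Fin n → Bool => σ j = false)} → ι)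
        (Subtype.val : {y // col y ∉ univ.filter (fun σ : Fin n → Bool => σ j = false)} → ι')).rank +
      (R.submatrix (Subtype.val : {x // row x ∈ univ.filter (fun σ : Fin n → Bool => σ j = true)} → ι)
        (Subtype.val : {y // col y ∉ univ.filter (fun σ : Fin n → Bool => σ j = true)} → ι')).rank ≤
      (Matrix.of fun x y => if row x j ≠ col y j then R x y else 0).rank := by
    intro j
    have hb := rank_blocks_le_of_lowerLeft_zero (Matrix.of fun x y => if row x j ≠ col y j then R x y else 0)
      (fun x => row x j = false) (fun y => col y j = true) (fun x y hx hy => by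
        have hx' : row x j = true := by simpa using hx
        simp [hx', hy])
    have e1 : (R.submatrix (Subtype.val : {x // row x ∈ univ.filter (fun σ : Fin n → Bool => σ j = false)} → ι)
        (Subtype.val : {y // col y ∉ univ.filter (fun σ : Fin n → Bool => σ j = false)} → ι')).rank =
        ((Matrix.of fun x y => if row x j ≠ col y j then R x y else 0).submatrix
          (Subtype.val : {x // row x j = false} → ι) (Subtype.val : {y // col y j = true} → ι')).rank := by
      rw [rank_submatrix_congr R (p' := fun x => row x j = false) (q' := fun y => col y j = true)
        (fun x => by simp) (fun y => by simp)]
      congr 1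
      ext x y
      simp only [Matrix.submatrix_apply, Matrix.of_apply]
      rw [if_pos]; rw [x.2, y.2]; decide
    have e2 : (R.submatrix (Subtype.val : {x // row x ∈ univ.filter (fun σ : Fin n → Bool => σ j = true)} → ι)
        (Subtype.val : {y // col y ∉ univ.filter (fun σ : Fin n → Bool => σ j = true)} → ι')).rank =
        ((Matrix.of fun x y => if row x j ≠ col y j then R x y else 0).submatrix
          (Subtype.val : {x // ¬ row x j = false} → ι) (Subtype.val : {y // ¬ col y j = true} → ι')).rank := by
      rw [rank_submatrix_congr R (p' := fun x => ¬ row x j = false) (q' := fun y => ¬ col y j = true)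
        (fun x => by simp) (fun y => by simp)]
      congr 1
      ext x y
      simp only [Matrix.submatrix_apply, Matrix.of_apply]
      have hx : row x.1 j = true := by simpa using x.2
      have hy : col y.1 j = false := by simpa using y.2
      rw [if_pos]; rw [hx, hy]; decide
    rw [e1, e2]; exact hb
  -- complements: rewrite the `Bᶜ` blocks
  have ecB : (R.submatrix (Subtype.val : {x // row x ∈ Bᶜ} → ι) (Subtype.val : {y // col y ∉ Bᶜ} → ι')).rank =
      (R.submatrix (Subtype.val : {x // row x ∉ B} → ι) (Subtype.val : {y // col y ∈ B} → ι')).rank :=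
    rank_submatrix_congr R (fun x => by simp) (fun y => by simp)
  have ccB : Fintype.card {y // col y ∈ Bᶜ} = Fintype.card {y // col y ∉ B} :=
    Fintype.card_congr (Equiv.subtypeEquivRight fun y => by simp)
  have ccompl : Fintype.card {y // col y ∉ B} + Fintype.card {y // col y ∈ B} = Fintype.card ι' := by
    rw [Fintype.card_subtype_compl, Nat.sub_add_cancel (Fintype.card_subtype_le _)]
  have cuniv : Fintype.card {y // col y ∈ (univ : Finset (Fin n → Bool))} = Fintype.card ι' := by
    rw [Fintype.card_eq.mpr ⟨Equiv.subtypeUnivEquiv (fun y => Finset.mem_univ _)⟩]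
  -- cardinalities of the coordinate halves add up to `#ι'`
  have chalf : ∀ j : Fin n, Fintype.card {y // col y ∈ univ.filter (fun σ : Fin n → Bool => σ j = false)} +
      Fintype.card {y // col y ∈ univ.filter (fun σ : Fin n → Bool => σ j = true)} = Fintype.card ι' := by
    intro j
    have e1 : Fintype.card {y // col y ∈ univ.filter (fun σ : Fin n → Bool => σ j = true)} =
        Fintype.card {y // ¬ (col y ∈ univ.filter (fun σ : Fin n → Bool => σ j = false))} :=
      Fintype.card_congr (Equiv.subtypeEquivRight fun y => by simp)
    rw [e1, Fintype.card_subtype_compl]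
    have := Fintype.card_subtype_le (fun y => col y ∈ univ.filter (fun σ : Fin n → Bool => σ j = false))
    omega
  -- assemble (in ℤ)
  have hsum : ∑ j : Fin n, (((Matrix.of fun (z : ι' ⊕ ι) (y' : ι') =>
        if Sum.elim col row z ∈ univ.filter (fun σ : Fin n → Bool => σ j = false)
        then Matrix.fromRows (1 : Matrix ι' ι' K) R z y' else 0).rank : ℤ) +
      ((Matrix.of fun (z : ι' ⊕ ι) (y' : ι') =>
        if Sum.elim col row z ∈ univ.filter (fun σ : Fin n → Bool => σ j = true)
        then Matrix.fromRows (1 : Matrix ι' ι' K) R z y' else 0).rank : ℤ)) ≤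
      ∑ j : Fin n, ((Fintype.card ι' : ℤ) + ((Matrix.of fun x y => if row x j ≠ col y j then R x y else 0).rank : ℤ)) := by
    apply Finset.sum_le_sum
    intro j _
    have h0 := hi j false
    have h1 := hi j true
    have h2 := hcut j
    have h3 := chalf j
    have hj : (Matrix.of fun (z : ι' ⊕ ι) (y' : ι') =>
        if Sum.elim col row z ∈ univ.filter (fun σ : Fin n → Bool => σ j = false)
        then Matrix.fromRows (1 : Matrix ι' ι' K) R z y' else 0).rank +
      (Matrix.of fun (z : ι' ⊕ ι) (y' : ι') =>
        if Sum.elim col row z ∈ univ.filter (fun σ : Fin n → Bool => σ j = true)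
        then Matrix.fromRows (1 : Matrix ι' ι' K) R z y' else 0).rank ≤
      Fintype.card ι' + (Matrix.of fun x y => if row x j ≠ col y j then R x y else 0).rank := by omega
    exact_mod_cast hj
  have hrhs : ∑ j : Fin n, ((Fintype.card ι' : ℤ) + ((Matrix.of fun x y => if row x j ≠ col y j then R x y else 0).rank : ℤ))
      = (n : ℤ) * Fintype.card ι' + ∑ j : Fin n, ((Matrix.of fun x y => if row x j ≠ col y j then R x y else 0).rank : ℤ) := by
    rw [Finset.sum_add_distrib, Finset.sum_const, Finset.card_univ, Fintype.card_fin]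
    simp
  rw [hrhs] at hsum
  -- upper bound for the full selection: the `univ × ∅` block is empty
  have hiU := rank_stack_le_card_add_rank (K := K) row col R (univ : Finset (Fin n → Bool))
  have hempty : (R.submatrix (Subtype.val : {x // row x ∈ (univ : Finset (Fin n → Bool))} → ι)
      (Subtype.val : {y // col y ∉ (univ : Finset (Fin n → Bool))} → ι')).rank = 0 := by
    have h0 : Fintype.card {y // col y ∉ (univ : Finset (Fin n → Bool))} = 0 := by simp
    have := Matrix.rank_le_card_width (R.submatrix (Subtype.val : {x // row x ∈ (univ : Finset (Fin n → Bool))} → ι)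
      (Subtype.val : {y // col y ∉ (univ : Finset (Fin n → Bool))} → ι'))
    omega
  rw [cuniv, hempty] at hiU
  rw [cuniv, hempty] at louniv
  rw [ccB, ecB] at loBc
  -- casts
  have eB := (Nat.cast_le (α := ℤ)).mpr loB
  have eBc := (Nat.cast_le (α := ℤ)).mpr loBc
  have eU := (Nat.cast_le (α := ℤ)).mpr louniv
  have eUhi := (Nat.cast_le (α := ℤ)).mpr hiU
  have eC := congrArg (Nat.cast : ℕ → ℤ) ccompl
  push_cast at eB eBc eU eUhi eC
  have key : ((R.submatrix (Subtype.val : {x // row x ∈ B} → ι) (Subtype.val : {y // col y ∉ B} → ι')).rank : ℤ) +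
      ((R.submatrix (Subtype.val : {x // row x ∉ B} → ι) (Subtype.val : {y // col y ∈ B} → ι')).rank : ℤ) ≤
      ∑ j : Fin n, ((Matrix.of fun x y => if row x j ≠ col y j then R x y else 0).rank : ℤ) := by
    have hUeq : ((Matrix.of fun (z : ι' ⊕ ι) (y' : ι') => if Sum.elim col row z ∈ (univ : Finset (Fin n → Bool)) then
        Matrix.fromRows (1 : Matrix ι' ι' K) R z y' else 0).rank : ℤ) = Fintype.card ι' := by linarith
    rw [hUeq] at main
    nlinarith [main, hsum, eB, eBc, eC]
  exact_mod_cast key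

end Cube

end Summit.PneNP.PneNP.Theorems.CnfIdealGenLengthRankDefectRepresentationsCutLemmaCutDominationMatrix
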